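import Summits.ResolutionOfSingularities.ResolutionOfSingularities.Theorems.EquisingularLiftEquisingularLiftNatUsefulTouchNonPrincipal
import Summits.ResolutionOfSingularities.ResolutionOfSingularities.Theorems.EquisingularLiftEquisingularLiftNatHorizontalForcedAmbient
import HarnessLib

/-!
# [OURS · L1 W4.5(b) · EL♮] T-FIRST-PROGRESS: along a successful horizontal chain there is a FIRST PROGRESS touch over `x`, and it
# sees the ORIGINAL local ring — any scheme, any `n`
# (crux `EquisingularLiftNat` = stmt-ResolutionOfSingularities-20038; K-∀n / K5-BMY necessity lane)

HONEST FRAMING. OURS (cell res-hironaka, crux chain w45b, slot W4.5(b)); NOT a statement of any manuscript; replaces the role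
of NOTHING in the manuscript; AI-written, AI review is weaker than expert review. Helper `--supports
stmt-ResolutionOfSingularities-20038 --as helper`. Closes the caveat §3″ of ULT-STATUS v4 (res-L1-w45b-lead-1): the by-hand first-touch
analyses (res-D-brk-4 K5-BMY STEP 0, res-L1-w45b-strat-1 census v3 §2, res-L1-w45b-lead-2 LEAD-MEMO-1 §3) work at the FIRST PROGRESS
touch with «`R̄ := 𝒪_{H_i, η_{S_i}} ≅ 𝒪_{H, η_S}`»; the kernel so far had this only for an AVOIDING prefix (p515851) and, at the other
end, the LAST (finishing) touch (p513560/p520241).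

WHAT. A PROGRESS touch over `x` is a step whose centre passes through the point over `x` of the reduced strict transform with
NON-PRINCIPAL trace there; a USELESS step (centre missing that point, or principal trace) is an isomorphism of the reduced strict
transforms near the point (blow-up off the centre / T-TRACE-ISO p518228). Hence, along any horizontal E1 chain whose end is regular,
starting from a NON-regular point `w₀` of `V(closure Y)` over `x`:

* `exists_first_progress_touch_of_horizChain` — there is a stage `(X₁, σ₁, Y₁)` in the horizontal closure (closure `Y₁` irreducible,
  not inside the centre), its UNIQUE point `w₁` over `x`, a ring isomorphism `𝒪_{V(closure Y), w₀} ≃+* 𝒪_{V(closure Y₁), w₁}`, and an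
  admissible step `τ = Bl_C` (regular, `O`-flat, off the generic point of `Y`, E1) with `ι w₁ ∈ supp C` and NON-PRINCIPAL trace
  `(C·𝒪_{V(closure Y₁)})_{w₁}` — the FIRST PROGRESS touch over `x`; all earlier steps were useless near the point over `x`.
* `exists_isIso_restrict_of_useless_step` — the useless-step lemma (both cases) in the currency of `exists_isBlowup_reducedStrictTransform`.
* `firstProgressTouch_of_equisingularLiftNat` — THE OBJECT in the item's currency (`ℙⁿ_O`; EL♮ ⇒ horizontal form, p510642): for every
  non-regular `h`, over the item's `(O, π)` and every `φ, Y`, the first progress touch over `x = (ι ≫ Proj.map φ) h` happens at a point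
  whose reduced local ring is isomorphic to that of `V(Y)` at its point over `x` (itself `≅ 𝒪_{H,h}`).

CONSEQUENCE (with T-FAT-NOT-FINISHING's ring core, p522183/p515200): hypotheses of the by-hand kill analyses that are INTRINSIC to the
`2`-dimensional reduced local ring (dimension, non-regularity, ANISOTROPY of the tangent cone) need only be verified on the specimen
`𝒪_{H, η_S}` itself, not at an unknown later stage.

References: tree `…NatTraceIso` (p518228), `…NatUsefulTouchNonPrincipal` (p520241), `…NatHorizontalForcedAmbient` (p510642),
`…NatStrictTransformClosureCompl`, `…ReducedStrictTransformBlowup` (Stacks 080E), Literature `Blowups` (GW I 13.91).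
-/

set_option linter.dupNamespace false -- mandated namespace `Summit.<Summit>.<Problem>` of this single-conjunct summit
set_option linter.overlappingInstances false -- item signatures carry `[IsDomain O] [IsDiscreteValuationRing O]`

universe u

open CategoryTheory AlgebraicGeometry TopologicalSpace Topology
open Literature.AlgebraicGeometry.Resolution
open AlgebraicGeometry.Scheme.IdealSheafData
open Summit.ResolutionOfSingularities.ResolutionOfSingularities.Cruxes.EquisingularLift.StrataSplit
open Summit.ResolutionOfSingularities.ResolutionOfSingularities.Theorems.EquisingularLift

namespace Summit.ResolutionOfSingularities.ResolutionOfSingularities.Cruxes.EquisingularLiftNat.Sections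

/-! ## A useless step is an isomorphism of the reduced strict transforms near the point -/

/-- **USELESS STEPS.** `τ : X′ → X` a blow-up along `C` (`X` locally Noetherian), `S ⊆ X` closed irreducible with `S ⊄ supp C`, and
`w ∈ V(S)` such that EITHER `ι w ∉ supp C` OR the trace `(C·𝒪_{V(S)})_w` is principal. Then the reduced strict transform
`ρ : V(closure τ⁻¹(S ∖ supp C)) → V(S)` (over `τ`, a blow-up along `C·𝒪_{V(S)}`) restricts to an ISOMORPHISM over an open `U ∋ w`
(blow-up off the centre, GW I 13.91 (3); or T-TRACE-ISO `exists_isIso_morphismRestrict_of_stalkIdeal_eq_span` — a zero trace would put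
`S` inside the centre, `support_eq_top_of_stalkIdeal_eq_bot`). [cite: GortzWedhorn2020, Prop. 13.91; StacksProject, Tag 080E] -/
theorem exists_isIso_restrict_of_useless_step {X X' : Scheme.{0}} [IsLocallyNoetherian X]
    (τ : X' ⟶ X) (C : X.IdealSheafData) (hτ : IsBlowup τ C)
    (S : Set X) (hS : IsClosed S) (hirr : IsIrreducible S) (hSC : ¬ S ⊆ (C.support : Set X))
    (w : ↥(vanishingIdeal (⟨S, hS⟩ : Closeds X)).subscheme)
    (huse : (vanishingIdeal (⟨S, hS⟩ : Closeds X)).subschemeι w ∉ (C.support : Set X) ∨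
      (stalkIdeal (C.comap (vanishingIdeal (⟨S, hS⟩ : Closeds X)).subschemeι) w).IsPrincipal) :
    ∃ ρ : (vanishingIdeal (⟨closure (τ ⁻¹' (S \ (C.support : Set X))), isClosed_closure⟩ : Closeds X')).subscheme ⟶
        (vanishingIdeal (⟨S, hS⟩ : Closeds X)).subscheme,
      ρ ≫ (vanishingIdeal (⟨S, hS⟩ : Closeds X)).subschemeι =
        (vanishingIdeal (⟨closure (τ ⁻¹' (S \ (C.support : Set X))), isClosed_closure⟩ : Closeds X')).subschemeι ≫ τ ∧
      ∃ U : (vanishingIdeal (⟨S, hS⟩ : Closeds X)).subscheme.Opens, w ∈ U ∧ IsIso (ρ ∣_ U) := by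
  haveI : IsProper τ := hτ.isProper
  haveI : IsLocallyNoetherian X' := LocallyOfFiniteType.isLocallyNoetherian τ
  obtain ⟨ρ, hρτ, -, hρ⟩ := exists_isBlowup_reducedStrictTransform X X' τ C hτ S hS hirr hSC
  haveI : IsIntegral (vanishingIdeal (⟨S, hS⟩ : Closeds X)).subscheme :=
    ComponentGluing.isIntegral_subscheme_vanishingIdeal ⟨S, hS⟩ hirr
  haveI : IsLocallyNoetherian (vanishingIdeal (⟨S, hS⟩ : Closeds X)).subscheme :=
    LocallyOfFiniteType.isLocallyNoetherian (vanishingIdeal (⟨S, hS⟩ : Closeds X)).subschemeι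
  refine ⟨ρ, hρτ, ?_⟩
  rcases huse with hwC | ⟨f, hf⟩
  · -- the centre misses the point: the blow-up is an isomorphism off its centre
    let U : (vanishingIdeal (⟨S, hS⟩ : Closeds X)).subscheme.Opens :=
      ⟨((C.comap (vanishingIdeal (⟨S, hS⟩ : Closeds X)).subschemeι).support : Set _)ᶜ,
        (C.comap _).support.isClosed.isOpen_compl⟩
    refine ⟨U, ?_, hρ.isIso_morphismRestrict disjoint_compl_left⟩
    change w ∉ ((C.comap (vanishingIdeal (⟨S, hS⟩ : Closeds X)).subschemeι).support : Set _)
    rw [Scheme.IdealSheafData.support_comap]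
    exact hwC
  · -- principal trace: T-TRACE-ISO (a zero trace is excluded by irreducibility)
    change stalkIdeal _ w = Ideal.span {f} at hf
    have hf0 : f ≠ 0 := by
      rintro rfl
      rw [Ideal.span_singleton_zero] at hf
      have hsupp := support_eq_top_of_stalkIdeal_eq_bot _ hf
      rw [support_comap, Closeds.coe_preimage, Set.eq_univ_iff_forall] at hsupp
      apply hSC
      intro y hy
      have hy' : y ∈ Set.range (vanishingIdeal (⟨S, hS⟩ : Closeds X)).subschemeι := by
        rw [ComponentGluing.range_subschemeι_vanishingIdeal]; exact hy
      obtain ⟨z, rfl⟩ := hy'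
      exact hsupp z
    exact exists_isIso_morphismRestrict_of_stalkIdeal_eq_span hρ hf hf0

/-- Bookkeeping for a local isomorphism `ρ ∣_ U` over `U ∋ w`: a UNIQUE point `w₂` over `w`, with invertible stalk map. [folklore] -/
theorem exists_unique_over_of_isIso_restrict {Z Z₂ : Scheme.{u}} (ρ : Z₂ ⟶ Z) {w : Z} {U : Z.Opens} (hwU : w ∈ U)
    (hiso : IsIso (ρ ∣_ U)) :
    ∃ w₂ : Z₂, ρ w₂ = w ∧ (∀ w' : Z₂, ρ w' = w → w' = w₂) ∧ IsIso (ρ.stalkMap w₂) := by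
  obtain ⟨z, hz⟩ := (ρ ∣_ U).surjective ⟨w, hwU⟩
  have hρz : ρ z.1 = w := by
    have h := morphismRestrict_base_coe ρ U z
    rw [hz] at h
    exact h.symm
  refine ⟨z.1, hρz, ?_, isIso_stalkMap_of_isIso_morphismRestrict' ρ U hiso (by rw [hρz]; exact hwU)⟩
  intro w' hw'
  have hw'U : w' ∈ ρ ⁻¹ᵁ U := by show ρ w' ∈ U; rw [hw']; exact hwU
  have hinj : Function.Injective (ρ ∣_ U) := (ρ ∣_ U).homeomorph.injective
  have key : (⟨w', hw'U⟩ : ↥(ρ ⁻¹ᵁ U)) = z := by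
    apply hinj
    apply Subtype.ext
    rw [morphismRestrict_base_coe, hz]
    exact hw'
  exact congrArg Subtype.val key

/-! ## THE FIRST PROGRESS TOUCH (general base) -/

/-- **THE FIRST PROGRESS TOUCH EXISTS AND SEES THE ORIGINAL LOCAL RING (general base).** `O` local, `q : P → Spec O` with `P` locally
Noetherian, `Y ⊆ P` with a generic point `ξ`, `w₀` a point of `V(closure Y)` over `x` whose local ring is NOT regular, and `(P′, σ, S′)`
a stage of the HORIZONTAL E1-closure of `(P, 𝟙, Y)` (steps: blow-up of a regular `O`-flat centre off the generic point of `Y`, E1) with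
`V(closure S′)` REGULAR. Then there are a stage `(X₁, σ₁, Y₁)` of that closure (closure `Y₁` irreducible), its UNIQUE point `w₁` over
`x`, a ring isomorphism `𝒪_{V(closure Y), w₀} ≃+* 𝒪_{V(closure Y₁), w₁}`, and an admissible step `τ : X₂ = Bl_C X₁ → X₁` with
`ι w₁ ∈ supp C`, `closure Y₁ ⊄ supp C` and NON-PRINCIPAL trace `(C·𝒪_{V(closure Y₁)})_{w₁}`. (Induction along the closure: while every
step is useless near the point over `x`, that point stays unique and its local ring unchanged — `exists_isIso_restrict_of_useless_step`;
a regular end forces a progress step.) [folklore] -/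
theorem exists_first_progress_touch_of_horizChain {O : Type} [CommRing O] [IsLocalRing O]
    {P : AlgebraicGeometry.Scheme.{0}} [AlgebraicGeometry.IsLocallyNoetherian P] (q : P ⟶ AlgebraicGeometry.Spec (.of O))
    (Y : Set P) {ξ : P} (hξ : IsGenericPoint ξ Y) (x : P)
    (w₀ : ↥(AlgebraicGeometry.Scheme.IdealSheafData.vanishingIdeal (⟨closure Y, isClosed_closure⟩ : TopologicalSpace.Closeds P)).subscheme) (hw₀ : (AlgebraicGeometry.Scheme.IdealSheafData.vanishingIdeal (⟨closure Y, isClosed_closure⟩ : TopologicalSpace.Closeds P)).subschemeι w₀ = x)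
    (hw₀reg : ¬ IsRegularLocalRing ((AlgebraicGeometry.Scheme.IdealSheafData.vanishingIdeal (⟨closure Y, isClosed_closure⟩ : TopologicalSpace.Closeds P)).subscheme.presheaf.stalk w₀))
    {P' : AlgebraicGeometry.Scheme.{0}} {σ : P' ⟶ P} {S' : Set P'}
    (hhr : (∀ Q : (∀ X' : AlgebraicGeometry.Scheme.{0}, (X' ⟶ P) → Set X' → Prop), Q P (CategoryTheory.CategoryStruct.id _) Y → (∀ (X' X'' : AlgebraicGeometry.Scheme.{0}) (σ' : X' ⟶ P) (Y' : Set X') (C : X'.IdealSheafData) (τ : X'' ⟶ X'), Q X' σ' Y' → Literature.AlgebraicGeometry.Resolution.IsBlowup τ C → Literature.AlgebraicGeometry.Resolution.Scheme.IsRegular C.subscheme → AlgebraicGeometry.Flat (CategoryTheory.CategoryStruct.comp C.subschemeι (CategoryTheory.CategoryStruct.comp σ' q)) → σ' '' (C.support : Set X') ⊆ {x | ¬ IsGenericPoint x Y} → (C.support : Set X') ∩ (CategoryTheory.CategoryStruct.comp σ' q) ⁻¹' {IsLocalRing.closedPoint O} ⊆ Y' → Q X'' (CategoryTheory.CategoryStruct.comp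 τ σ') (closure (τ ⁻¹' (Y' \ (C.support : Set X'))))) → Q P' σ S'))
    (hreg : Literature.AlgebraicGeometry.Resolution.Scheme.IsRegular (AlgebraicGeometry.Scheme.IdealSheafData.vanishingIdeal (⟨closure S', isClosed_closure⟩ : TopologicalSpace.Closeds P')).subscheme) :
    ∃ (X₁ : AlgebraicGeometry.Scheme.{0}) (σ₁ : X₁ ⟶ P) (Y₁ : Set X₁), (∀ Q : (∀ X' : AlgebraicGeometry.Scheme.{0}, (X' ⟶ P) → Set X' → Prop), Q P (CategoryTheory.CategoryStruct.id _) Y → (∀ (X' X'' : AlgebraicGeometry.Scheme.{0}) (σ' : X' ⟶ P) (Y' : Set X') (C : X'.IdealSheafData) (τ : X'' ⟶ X'), Q X' σ' Y' → Literature.AlgebraicGeometry.Resolution.IsBlowup τ C → Literature.AlgebraicGeometry.Resolution.Scheme.IsRegular C.subscheme → AlgebraicGeometry.Flat (CategoryTheory.CategoryStruct.comp C.subschemeι (CategoryTheory.CategoryStruct.comp σ' q)) → σ' '' (C.support : Set X') ⊆ {x | ¬ IsGenericPoint x Y} → (C.support : Set X') ∩ (CategoryTheory.CategoryStruct.comp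 σ' q) ⁻¹' {IsLocalRing.closedPoint O} ⊆ Y' → Q X'' (CategoryTheory.CategoryStruct.comp τ σ') (closure (τ ⁻¹' (Y' \ (C.support : Set X'))))) → Q X₁ σ₁ Y₁) ∧
      IsIrreducible (closure Y₁) ∧
      ∃ (w₁ : ↥(AlgebraicGeometry.Scheme.IdealSheafData.vanishingIdeal (⟨closure Y₁, isClosed_closure⟩ : TopologicalSpace.Closeds X₁)).subscheme) (C : X₁.IdealSheafData) (X₂ : AlgebraicGeometry.Scheme.{0}) (τ : X₂ ⟶ X₁),
        σ₁ ((AlgebraicGeometry.Scheme.IdealSheafData.vanishingIdeal (⟨closure Y₁, isClosed_closure⟩ : TopologicalSpace.Closeds X₁)).subschemeι w₁) = x ∧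
        (∀ w' : ↥(AlgebraicGeometry.Scheme.IdealSheafData.vanishingIdeal (⟨closure Y₁, isClosed_closure⟩ : TopologicalSpace.Closeds X₁)).subscheme, σ₁ ((AlgebraicGeometry.Scheme.IdealSheafData.vanishingIdeal (⟨closure Y₁, isClosed_closure⟩ : TopologicalSpace.Closeds X₁)).subschemeι w') = x → w' = w₁) ∧
        Nonempty ((AlgebraicGeometry.Scheme.IdealSheafData.vanishingIdeal (⟨closure Y, isClosed_closure⟩ : TopologicalSpace.Closeds P)).subscheme.presheaf.stalk w₀ ≃+* (AlgebraicGeometry.Scheme.IdealSheafData.vanishingIdeal (⟨closure Y₁, isClosed_closure⟩ : TopologicalSpace.Closeds X₁)).subscheme.presheaf.stalk w₁) ∧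
        Literature.AlgebraicGeometry.Resolution.IsBlowup τ C ∧ Literature.AlgebraicGeometry.Resolution.Scheme.IsRegular C.subscheme ∧
        AlgebraicGeometry.Flat (CategoryTheory.CategoryStruct.comp C.subschemeι (CategoryTheory.CategoryStruct.comp σ₁ q)) ∧
        σ₁ '' (C.support : Set X₁) ⊆ {x | ¬ IsGenericPoint x Y} ∧
        (C.support : Set X₁) ∩ (CategoryTheory.CategoryStruct.comp σ₁ q) ⁻¹' {IsLocalRing.closedPoint O} ⊆ Y₁ ∧
        (AlgebraicGeometry.Scheme.IdealSheafData.vanishingIdeal (⟨closure Y₁, isClosed_closure⟩ : TopologicalSpace.Closeds X₁)).subschemeι w₁ ∈ (C.support : Set X₁) ∧ ¬ closure Y₁ ⊆ (C.support : Set X₁) ∧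
        ¬ (stalkIdeal (C.comap (AlgebraicGeometry.Scheme.IdealSheafData.vanishingIdeal (⟨closure Y₁, isClosed_closure⟩ : TopologicalSpace.Closeds X₁)).subschemeι) w₁).IsPrincipal := by
  -- the motive: (already FOUND) ∨ (NOT FOUND: a unique point over `x`, with unchanged local ring)
  let HRp : ∀ X₁ : Scheme.{0}, (X₁ ⟶ P) → Set X₁ → Prop := fun X₁ σ₁ Y₁ => (∀ Q : (∀ X' : AlgebraicGeometry.Scheme.{0}, (X' ⟶ P) → Set X' → Prop), Q P (CategoryTheory.CategoryStruct.id _) Y → (∀ (X' X'' : AlgebraicGeometry.Scheme.{0}) (σ' : X' ⟶ P) (Y' : Set X') (C : X'.IdealSheafData) (τ : X'' ⟶ X'), Q X' σ' Y' → Literature.AlgebraicGeometry.Resolution.IsBlowup τ C → Literature.AlgebraicGeometry.Resolution.Scheme.IsRegular C.subscheme → AlgebraicGeometry.Flat (CategoryTheory.CategoryStruct.comp C.subschemeι (CategoryTheory.CategoryStruct.comp σ' q)) → σ' '' (C.support : Set X') ⊆ {x | ¬ IsGenericPoint x Y} → (C.support : Set X') ∩ (CategoryTheory.CategoryStruct.comp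 σ' q) ⁻¹' {IsLocalRing.closedPoint O} ⊆ Y' → Q X'' (CategoryTheory.CategoryStruct.comp τ σ') (closure (τ ⁻¹' (Y' \ (C.support : Set X'))))) → Q X₁ σ₁ Y₁)
  let NF : ∀ X' : Scheme.{0}, (X' ⟶ P) → Set X' → Prop := fun X' σ' Y' =>
    ∃ w : ↥(AlgebraicGeometry.Scheme.IdealSheafData.vanishingIdeal (⟨closure Y', isClosed_closure⟩ : TopologicalSpace.Closeds X')).subscheme, σ' ((AlgebraicGeometry.Scheme.IdealSheafData.vanishingIdeal (⟨closure Y', isClosed_closure⟩ : TopologicalSpace.Closeds X')).subschemeι w) = x ∧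
      (∀ w' : ↥(AlgebraicGeometry.Scheme.IdealSheafData.vanishingIdeal (⟨closure Y', isClosed_closure⟩ : TopologicalSpace.Closeds X')).subscheme, σ' ((AlgebraicGeometry.Scheme.IdealSheafData.vanishingIdeal (⟨closure Y', isClosed_closure⟩ : TopologicalSpace.Closeds X')).subschemeι w') = x → w' = w) ∧
      Nonempty ((AlgebraicGeometry.Scheme.IdealSheafData.vanishingIdeal (⟨closure Y, isClosed_closure⟩ : TopologicalSpace.Closeds P)).subscheme.presheaf.stalk w₀ ≃+* (AlgebraicGeometry.Scheme.IdealSheafData.vanishingIdeal (⟨closure Y', isClosed_closure⟩ : TopologicalSpace.Closeds X')).subscheme.presheaf.stalk w)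
  have key := hhr (fun X' σ' Y' => IsLocallyNoetherian X' ∧ HRp X' σ' Y' ∧ ((∃ (X₁ : AlgebraicGeometry.Scheme.{0}) (σ₁ : X₁ ⟶ P) (Y₁ : Set X₁), (∀ Q : (∀ X' : AlgebraicGeometry.Scheme.{0}, (X' ⟶ P) → Set X' → Prop), Q P (CategoryTheory.CategoryStruct.id _) Y → (∀ (X' X'' : AlgebraicGeometry.Scheme.{0}) (σ' : X' ⟶ P) (Y' : Set X') (C : X'.IdealSheafData) (τ : X'' ⟶ X'), Q X' σ' Y' → Literature.AlgebraicGeometry.Resolution.IsBlowup τ C → Literature.AlgebraicGeometry.Resolution.Scheme.IsRegular C.subscheme → AlgebraicGeometry.Flat (CategoryTheory.CategoryStruct.comp C.subschemeι (CategoryTheory.CategoryStruct.comp σ' q)) → σ' '' (C.support : Set X') ⊆ {x | ¬ IsGenericPoint x Y} → (C.support : Set X') ∩ (CategoryTheory.CategoryStruct.comp σ' q) ⁻¹' {IsLocalRing.closedPoint O} ⊆ Y' → Q X'' (CategoryTheory.CategoryStruct.comp τ σ') (closure (τ ⁻¹' (Y' \ (C.support : Set X'))))) → Q X₁ σ₁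 Y₁) ∧
      IsIrreducible (closure Y₁) ∧
      ∃ (w₁ : ↥(AlgebraicGeometry.Scheme.IdealSheafData.vanishingIdeal (⟨closure Y₁, isClosed_closure⟩ : TopologicalSpace.Closeds X₁)).subscheme) (C : X₁.IdealSheafData) (X₂ : AlgebraicGeometry.Scheme.{0}) (τ : X₂ ⟶ X₁),
        σ₁ ((AlgebraicGeometry.Scheme.IdealSheafData.vanishingIdeal (⟨closure Y₁, isClosed_closure⟩ : TopologicalSpace.Closeds X₁)).subschemeι w₁) = x ∧
        (∀ w' : ↥(AlgebraicGeometry.Scheme.IdealSheafData.vanishingIdeal (⟨closure Y₁, isClosed_closure⟩ : TopologicalSpace.Closeds X₁)).subscheme, σ₁ ((AlgebraicGeometry.Scheme.IdealSheafData.vanishingIdeal (⟨closure Y₁, isClosed_closure⟩ : TopologicalSpace.Closeds X₁)).subschemeι w') = x → w' = w₁) ∧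
        Nonempty ((AlgebraicGeometry.Scheme.IdealSheafData.vanishingIdeal (⟨closure Y, isClosed_closure⟩ : TopologicalSpace.Closeds P)).subscheme.presheaf.stalk w₀ ≃+* (AlgebraicGeometry.Scheme.IdealSheafData.vanishingIdeal (⟨closure Y₁, isClosed_closure⟩ : TopologicalSpace.Closeds X₁)).subscheme.presheaf.stalk w₁) ∧
        Literature.AlgebraicGeometry.Resolution.IsBlowup τ C ∧ Literature.AlgebraicGeometry.Resolution.Scheme.IsRegular C.subscheme ∧
        AlgebraicGeometry.Flat (CategoryTheory.CategoryStruct.comp C.subschemeι (CategoryTheory.CategoryStruct.comp σ₁ q)) ∧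
        σ₁ '' (C.support : Set X₁) ⊆ {x | ¬ IsGenericPoint x Y} ∧
        (C.support : Set X₁) ∩ (CategoryTheory.CategoryStruct.comp σ₁ q) ⁻¹' {IsLocalRing.closedPoint O} ⊆ Y₁ ∧
        (AlgebraicGeometry.Scheme.IdealSheafData.vanishingIdeal (⟨closure Y₁, isClosed_closure⟩ : TopologicalSpace.Closeds X₁)).subschemeι w₁ ∈ (C.support : Set X₁) ∧ ¬ closure Y₁ ⊆ (C.support : Set X₁) ∧
        ¬ (stalkIdeal (C.comap (AlgebraicGeometry.Scheme.IdealSheafData.vanishingIdeal (⟨closure Y₁, isClosed_closure⟩ : TopologicalSpace.Closeds X₁)).subschemeι) w₁).IsPrincipal) ∨ NF X' σ' Y')) ?_ ?_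
  · obtain ⟨-, -, hF | ⟨w, -, -, ⟨e⟩⟩⟩ := key
    · exact hF
    · haveI := hreg w
      exact absurd (IsRegularLocalRing.of_ringEquiv e.symm) hw₀reg
  · -- base `(P, 𝟙, Y)`
    refine ⟨inferInstance, fun Q h0 _ => h0, Or.inr ⟨w₀, by simpa using hw₀, ?_, ⟨RingEquiv.refl _⟩⟩⟩
    intro w' hw'
    apply (AlgebraicGeometry.Scheme.IdealSheafData.vanishingIdeal (⟨closure Y, isClosed_closure⟩ : TopologicalSpace.Closeds P)).subschemeι.isClosedEmbedding.injective
    have hw'' : (AlgebraicGeometry.Scheme.IdealSheafData.vanishingIdeal (⟨closure Y, isClosed_closure⟩ : TopologicalSpace.Closeds P)).subschemeι w' = x := by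
      simpa using hw'
    rw [hw'', hw₀]
  · intro X' X'' σ' Y' C τ hQ hbl hC hflat hgen hE1
    obtain ⟨hN, hhr', hQ⟩ := hQ
    haveI := hN
    haveI : IsProper τ := hbl.isProper
    haveI : IsLocallyNoetherian X'' := LocallyOfFiniteType.isLocallyNoetherian τ
    have hhr'' : HRp X'' (CategoryTheory.CategoryStruct.comp τ σ') (closure (τ ⁻¹' (Y' \ (C.support : Set X')))) :=
      fun Q h0 hs => hs X' X'' σ' Y' C τ (hhr' Q h0 hs) hbl hC hflat hgen hE1
    refine ⟨inferInstance, hhr'', ?_⟩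
    rcases hQ with hF | ⟨w, hwx, huniq, ⟨e⟩⟩
    · exact Or.inl hF
    · obtain ⟨hirr', hYC⟩ := isIrreducible_closure_and_not_subset_of_horizChain q Y hξ hhr' C hgen
      by_cases hprog : (AlgebraicGeometry.Scheme.IdealSheafData.vanishingIdeal (⟨closure Y', isClosed_closure⟩ : TopologicalSpace.Closeds X')).subschemeι w ∈ (C.support : Set X') ∧
          ¬ (stalkIdeal (C.comap (AlgebraicGeometry.Scheme.IdealSheafData.vanishingIdeal (⟨closure Y', isClosed_closure⟩ : TopologicalSpace.Closeds X')).subschemeι) w).IsPrincipal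
      · -- the FIRST PROGRESS touch is this step
        exact Or.inl ⟨X', σ', Y', hhr', hirr', w, C, X'', τ, hwx, huniq, ⟨e⟩, hbl, hC, hflat, hgen, hE1, hprog.1, hYC, hprog.2⟩
      · -- a useless step: the point over `x` stays unique with the same local ring
        have huse : (AlgebraicGeometry.Scheme.IdealSheafData.vanishingIdeal (⟨closure Y', isClosed_closure⟩ : TopologicalSpace.Closeds X')).subschemeι w ∉ (C.support : Set X') ∨
            (stalkIdeal (C.comap (AlgebraicGeometry.Scheme.IdealSheafData.vanishingIdeal (⟨closure Y', isClosed_closure⟩ : TopologicalSpace.Closeds X')).subschemeι) w).IsPrincipal := by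
          by_cases h1 : (AlgebraicGeometry.Scheme.IdealSheafData.vanishingIdeal (⟨closure Y', isClosed_closure⟩ : TopologicalSpace.Closeds X')).subschemeι w ∈ (C.support : Set X')
          · right; by_contra h2; exact hprog ⟨h1, h2⟩
          · exact Or.inl h1
        obtain ⟨ρ, hρτ, U, hwU, hiso⟩ :=
          exists_isIso_restrict_of_useless_step τ C hbl (closure Y') isClosed_closure hirr' hYC w huse
        have E : (⟨closure (closure (τ ⁻¹' (Y' \ (C.support : Set X')))), isClosed_closure⟩ : Closeds X'') =
            ⟨closure (τ ⁻¹' (closure Y' \ (C.support : Set X'))), isClosed_closure⟩ :=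
          Closeds.ext (show closure (closure (τ ⁻¹' (Y' \ (C.support : Set X')))) = closure (τ ⁻¹' (closure Y' \ (C.support : Set X'))) by
            rw [closure_closure]; exact closure_preimage_diff_support_eq_of_isBlowup hbl Y')
        suffices H : ∀ A : Closeds X'', A = ⟨closure (τ ⁻¹' (closure Y' \ (C.support : Set X'))), isClosed_closure⟩ →
            ∃ w'' : ↥(vanishingIdeal A).subscheme, (CategoryTheory.CategoryStruct.comp τ σ') ((vanishingIdeal A).subschemeι w'') = x ∧
              (∀ w' : ↥(vanishingIdeal A).subscheme, (CategoryTheory.CategoryStruct.comp τ σ') ((vanishingIdeal A).subschemeι w') = x → w' = w'') ∧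
              Nonempty ((AlgebraicGeometry.Scheme.IdealSheafData.vanishingIdeal (⟨closure Y, isClosed_closure⟩ : TopologicalSpace.Closeds P)).subscheme.presheaf.stalk w₀ ≃+* (vanishingIdeal A).subscheme.presheaf.stalk w'') by
          exact Or.inr (H _ E)
        rintro A rfl
        obtain ⟨w₂, hρw₂, huniq₂, hst⟩ := exists_unique_over_of_isIso_restrict ρ hwU hiso
        have hover : ∀ z, (CategoryTheory.CategoryStruct.comp τ σ')
            ((vanishingIdeal (⟨closure (τ ⁻¹' (closure Y' \ (C.support : Set X'))), isClosed_closure⟩ : Closeds X'')).subschemeι z) =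
            σ' ((AlgebraicGeometry.Scheme.IdealSheafData.vanishingIdeal (⟨closure Y', isClosed_closure⟩ : TopologicalSpace.Closeds X')).subschemeι (ρ z)) := by
          intro z
          have h := congrArg (fun φ => φ z) hρτ
          simp only [Scheme.Hom.comp_apply] at h ⊢
          rw [← h]
        refine ⟨w₂, by rw [hover, hρw₂, hwx], fun w' hw' => huniq₂ w' (huniq _ (by rw [← hover]; exact hw')), ?_⟩
        subst hρw₂
        exact ⟨e.trans (asIso (ρ.stalkMap w₂)).commRingCatIsoToRingEquiv⟩

/-! ## THE OBJECT: `EquisingularLiftNat p` ⇒ the first progress touch over every non-regular point sees the original local ring -/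

/-- **[OURS · L1 W4.5(b)] `EquisingularLiftNat p` ⇒ THE FIRST PROGRESS TOUCH SEES THE ORIGINAL SINGULARITY.** If the item EL♮ holds
at `p`, then for every instance `(k, n, H, ι)`, every point `h` of `H` with non-regular local ring, the `O, π` the item provides and
every `φ, Y`, writing `x := (ι ≫ Proj.map φ) h`: the point `w₀` of `V(Y)` over `x` (local ring `≅ 𝒪_{H,h}`, NOT regular) and a
stage `(X₁, σ₁, Y₁)` of the HORIZONTAL E1-closure of `(ℙⁿ_O, 𝟙, Y)` (EL♮ ⇒ its horizontal form, p510642) with closure `Y₁` irreducible,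
whose UNIQUE point `w₁` over `x` has local ring ISOMORPHIC to `𝒪_{V(Y), w₀}`, together with an admissible step `τ : X₂ = Bl_C X₁ → X₁`
(regular, `O`-flat, off the generic point, E1) through `ι w₁` with NON-PRINCIPAL trace at `w₁` — the first progress touch over `x`.
Base facts for `ℙⁿ_O` as in `usefulTouch_of_equisingularLiftNat` (p513560). [folklore] -/
theorem firstProgressTouch_of_equisingularLiftNat {p : ℕ}
    (hE : Summit.ResolutionOfSingularities.ResolutionOfSingularities.Theorems.EquisingularLiftNat p) :
    p.Prime → ∀ (k : Type) [Field k] [CharP k p] [IsAlgClosed k] (n : ℕ) (H : AlgebraicGeometry.Scheme.{0}) (ι : H ⟶ (Literature.AlgebraicGeometry.Motives.projectiveSpace n k).left), AlgebraicGeometry.IsClosedImmersion ι → AlgebraicGeometry.IsIntegral H → (∀ y : (Literature.AlgebraicGeometry.Motives.projectiveSpace n k).left, ∃ U : (Literature.AlgebraicGeometry.Motives.projectiveSpace n k).left.affineOpens, y ∈ (U : (Literature.AlgebraicGeometry.Motives.projectiveSpace n k).left.Opens) ∧ (ι.ker.ideal U).IsPrincipal) → ∀ (h : H), ¬ IsRegularLocalRing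 (H.presheaf.stalk h) → ∃ (O : Type) (_ : CommRing O) (_ : IsDomain O) (_ : IsDiscreteValuationRing O) (_ : CharZero O) (π : O →+* k), Function.Surjective π ∧ (letI := MvPolynomial.gradedAlgebra (σ := Fin (n + 1)) (R := O); letI := MvPolynomial.gradedAlgebra (σ := Fin (n + 1)) (R := k); ∀ (φ : MvPolynomial.homogeneousSubmodule (Fin (n + 1)) O →+*ᵍ MvPolynomial.homogeneousSubmodule (Fin (n + 1)) k) (hφ' : HomogeneousIdeal.irrelevant (MvPolynomial.homogeneousSubmodule (Fin (n + 1)) k) ≤ (HomogeneousIdeal.irrelevant (MvPolynomial.homogeneousSubmodule (Fin (n + 1)) O)).map φ), (∀ s, φ s = MvPolynomial.map π s) → ∀ Y : Set (AlgebraicGeometry.Proj (MvPolynomial.homogeneousSubmodule (Fin (n + 1)) O)), Y = Set.range (CategoryTheory.CategoryStruct.comp ι (AlgebraicGeometry.Proj.map φ hφ') : H ⟶ (AlgebraicGeometry.Proj (MvPolynomial.homogeneousSubmodule (Fin (n + 1)) O))) → ∃ w₀ : ↥(AlgebraicGeometry.Scheme.IdealSheafData.vanishingIdeal (⟨closure Y,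 isClosed_closure⟩ : TopologicalSpace.Closeds (AlgebraicGeometry.Proj (MvPolynomial.homogeneousSubmodule (Fin (n + 1)) O)))).subscheme, (AlgebraicGeometry.Scheme.IdealSheafData.vanishingIdeal (⟨closure Y, isClosed_closure⟩ : TopologicalSpace.Closeds (AlgebraicGeometry.Proj (MvPolynomial.homogeneousSubmodule (Fin (n + 1)) O)))).subschemeι w₀ = ((CategoryTheory.CategoryStruct.comp ι (AlgebraicGeometry.Proj.map φ hφ') : H ⟶ (AlgebraicGeometry.Proj (MvPolynomial.homogeneousSubmodule (Fin (n + 1)) O))) h) ∧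
      ¬ IsRegularLocalRing ((AlgebraicGeometry.Scheme.IdealSheafData.vanishingIdeal (⟨closure Y, isClosed_closure⟩ : TopologicalSpace.Closeds (AlgebraicGeometry.Proj (MvPolynomial.homogeneousSubmodule (Fin (n + 1)) O)))).subscheme.presheaf.stalk w₀) ∧
      ∃ (X₁ : AlgebraicGeometry.Scheme.{0}) (σ₁ : X₁ ⟶ (AlgebraicGeometry.Proj (MvPolynomial.homogeneousSubmodule (Fin (n + 1)) O))) (Y₁ : Set X₁), (∀ Q : (∀ X' : AlgebraicGeometry.Scheme.{0}, (X' ⟶ (AlgebraicGeometry.Proj (MvPolynomial.homogeneousSubmodule (Fin (n + 1)) O))) → Set X' → Prop), Q (AlgebraicGeometry.Proj (MvPolynomial.homogeneousSubmodule (Fin (n + 1)) O)) (CategoryTheory.CategoryStruct.id _) Y → (∀ (X' X'' : AlgebraicGeometry.Scheme.{0}) (σ' : X' ⟶ (AlgebraicGeometry.Proj (MvPolynomial.homogeneousSubmodule (Fin (n + 1)) O))) (Y' : Set X') (C : X'.IdealSheafData) (τ : X'' ⟶ X'), Q X' σ' Y' → Literature.AlgebraicGeometry.Resolution.IsBlowup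 τ C → Literature.AlgebraicGeometry.Resolution.Scheme.IsRegular C.subscheme → AlgebraicGeometry.Flat (CategoryTheory.CategoryStruct.comp C.subschemeι (CategoryTheory.CategoryStruct.comp σ' (CategoryTheory.CategoryStruct.comp (AlgebraicGeometry.Proj.toSpecZero (MvPolynomial.homogeneousSubmodule (Fin (n + 1)) O)) (AlgebraicGeometry.Spec.map (CommRingCat.ofHom (algebraMap O (MvPolynomial.homogeneousSubmodule (Fin (n + 1)) O 0))))))) → σ' '' (C.support : Set X') ⊆ {x | ¬ IsGenericPoint x Y} → (C.support : Set X') ∩ (CategoryTheory.CategoryStruct.comp σ' (CategoryTheory.CategoryStruct.comp (AlgebraicGeometry.Proj.toSpecZero (MvPolynomial.homogeneousSubmodule (Fin (n + 1)) O)) (AlgebraicGeometry.Spec.map (CommRingCat.ofHom (algebraMap O (MvPolynomial.homogeneousSubmodule (Fin (n + 1)) O 0)))))) ⁻¹' {IsLocalRing.closedPoint O} ⊆ Y' → Q X'' (CategoryTheory.CategoryStruct.comp τ σ') (closure (τ ⁻¹' (Y' \ (C.support : Set X'))))) → Q X₁ σ₁ Y₁) ∧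
      IsIrreducible (closure Y₁) ∧
      ∃ (w₁ : ↥(AlgebraicGeometry.Scheme.IdealSheafData.vanishingIdeal (⟨closure Y₁, isClosed_closure⟩ : TopologicalSpace.Closeds X₁)).subscheme) (C : X₁.IdealSheafData) (X₂ : AlgebraicGeometry.Scheme.{0}) (τ : X₂ ⟶ X₁),
        σ₁ ((AlgebraicGeometry.Scheme.IdealSheafData.vanishingIdeal (⟨closure Y₁, isClosed_closure⟩ : TopologicalSpace.Closeds X₁)).subschemeι w₁) = ((CategoryTheory.CategoryStruct.comp ι (AlgebraicGeometry.Proj.map φ hφ') : H ⟶ (AlgebraicGeometry.Proj (MvPolynomial.homogeneousSubmodule (Fin (n + 1)) O))) h) ∧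
        (∀ w' : ↥(AlgebraicGeometry.Scheme.IdealSheafData.vanishingIdeal (⟨closure Y₁, isClosed_closure⟩ : TopologicalSpace.Closeds X₁)).subscheme, σ₁ ((AlgebraicGeometry.Scheme.IdealSheafData.vanishingIdeal (⟨closure Y₁, isClosed_closure⟩ : TopologicalSpace.Closeds X₁)).subschemeι w') = ((CategoryTheory.CategoryStruct.comp ι (AlgebraicGeometry.Proj.map φ hφ') : H ⟶ (AlgebraicGeometry.Proj (MvPolynomial.homogeneousSubmodule (Fin (n + 1)) O))) h) → w' = w₁) ∧
        Nonempty ((AlgebraicGeometry.Scheme.IdealSheafData.vanishingIdeal (⟨closure Y, isClosed_closure⟩ : TopologicalSpace.Closeds (AlgebraicGeometry.Proj (MvPolynomial.homogeneousSubmodule (Fin (n + 1)) O)))).subscheme.presheaf.stalk w₀ ≃+* (AlgebraicGeometry.Scheme.IdealSheafData.vanishingIdeal (⟨closure Y₁, isClosed_closure⟩ : TopologicalSpace.Closeds X₁)).subscheme.presheaf.stalk w₁) ∧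
        Literature.AlgebraicGeometry.Resolution.IsBlowup τ C ∧ Literature.AlgebraicGeometry.Resolution.Scheme.IsRegular C.subscheme ∧
        AlgebraicGeometry.Flat (CategoryTheory.CategoryStruct.comp C.subschemeι (CategoryTheory.CategoryStruct.comp σ₁ (CategoryTheory.CategoryStruct.comp (AlgebraicGeometry.Proj.toSpecZero (MvPolynomial.homogeneousSubmodule (Fin (n + 1)) O)) (AlgebraicGeometry.Spec.map (CommRingCat.ofHom (algebraMap O (MvPolynomial.homogeneousSubmodule (Fin (n + 1)) O 0))))))) ∧
        σ₁ '' (C.support : Set X₁) ⊆ {x | ¬ IsGenericPoint x Y} ∧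
        (C.support : Set X₁) ∩ (CategoryTheory.CategoryStruct.comp σ₁ (CategoryTheory.CategoryStruct.comp (AlgebraicGeometry.Proj.toSpecZero (MvPolynomial.homogeneousSubmodule (Fin (n + 1)) O)) (AlgebraicGeometry.Spec.map (CommRingCat.ofHom (algebraMap O (MvPolynomial.homogeneousSubmodule (Fin (n + 1)) O 0)))))) ⁻¹' {IsLocalRing.closedPoint O} ⊆ Y₁ ∧
        (AlgebraicGeometry.Scheme.IdealSheafData.vanishingIdeal (⟨closure Y₁, isClosed_closure⟩ : TopologicalSpace.Closeds X₁)).subschemeι w₁ ∈ (C.support : Set X₁) ∧ ¬ closure Y₁ ⊆ (C.support : Set X₁) ∧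
        ¬ (stalkIdeal (C.comap (AlgebraicGeometry.Scheme.IdealSheafData.vanishingIdeal (⟨closure Y₁, isClosed_closure⟩ : TopologicalSpace.Closeds X₁)).subschemeι) w₁).IsPrincipal) := by
  intro hp k _ _ _ n H ι hι hH hloc h hreg
  obtain ⟨O, i1, i2, i3, i4, π, hπ, h'⟩ := hE hp k n H ι hι hH hloc
  refine ⟨O, i1, i2, i3, i4, π, hπ, ?_⟩
  letI := MvPolynomial.gradedAlgebra (σ := Fin (n + 1)) (R := O)
  letI := MvPolynomial.gradedAlgebra (σ := Fin (n + 1)) (R := k)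
  intro φ hφ' hφ Y hY
  haveI := hH
  have hHreg : ¬ Literature.AlgebraicGeometry.Resolution.Scheme.IsRegular H := fun hR => hreg (hR h)
  obtain ⟨P', σ, S', hhr, hregS⟩ := horizontal_of_elNatOver hι hH hHreg hπ h' φ hφ' hφ Y hY
  -- the base `q : ℙⁿ_O → Spec O` is proper, hence `ℙⁿ_O` is locally Noetherian
  obtain ⟨-, hprop⟩ := stub_projectiveAmbientSmoothProper O n
  haveI : IsProper (CategoryTheory.CategoryStruct.comp (AlgebraicGeometry.Proj.toSpecZero (MvPolynomial.homogeneousSubmodule (Fin (n + 1)) O)) (AlgebraicGeometry.Spec.map (CommRingCat.ofHom (algebraMap O (MvPolynomial.homogeneousSubmodule (Fin (n + 1)) O 0))))) := hprop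
  haveI : IsNoetherianRing (CommRingCat.of O) := inferInstanceAs (IsNoetherianRing O)
  haveI : IsLocallyNoetherian (AlgebraicGeometry.Proj (MvPolynomial.homogeneousSubmodule (Fin (n + 1)) O)) := LocallyOfFiniteType.isLocallyNoetherian (CategoryTheory.CategoryStruct.comp (AlgebraicGeometry.Proj.toSpecZero (MvPolynomial.homogeneousSubmodule (Fin (n + 1)) O)) (AlgebraicGeometry.Spec.map (CommRingCat.ofHom (algebraMap O (MvPolynomial.homogeneousSubmodule (Fin (n + 1)) O 0)))))
  -- the comparison `g : ℙⁿ_k → ℙⁿ_O` is a closed immersion, so `Y = range (ι ≫ g)` is closed with generic point the image of `η_H`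
  set g : Proj (MvPolynomial.homogeneousSubmodule (Fin (n + 1)) k) ⟶ (AlgebraicGeometry.Proj (MvPolynomial.homogeneousSubmodule (Fin (n + 1)) O)) := Proj.map φ hφ' with hg
  have hP := ProjectiveAmbientFibre.isPullback_projMap π φ hφ hπ hφ'
  haveI : IsClosedImmersion (Spec.map (CommRingCat.ofHom π)) := IsClosedImmersion.spec_of_surjective _ hπ
  haveI hgci : IsClosedImmersion g := MorphismProperty.IsStableUnderBaseChange.of_isPullback hP.flip inferInstance
  let ι' : H ⟶ Proj (MvPolynomial.homogeneousSubmodule (Fin (n + 1)) k) := ι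
  haveI : IsClosedImmersion ι' := hι
  have hYcl : IsClosed Y := by rw [hY]; exact (ι' ≫ g).isClosedEmbedding.isClosed_range
  have hξ : IsGenericPoint ((ι' ≫ g) (genericPoint H)) Y := by
    have h1 := (genericPoint_spec H).image (ι' ≫ g).base.hom.continuous
    rw [Set.image_univ] at h1
    have h2 : closure (Set.range ⇑(ι' ≫ g)) = Y := by
      have e : Set.range ⇑(ι' ≫ g) = Y := hY.symm
      rw [e]; exact hYcl.closure_eq
    rw [h2] at h1
    exact h1
  -- the non-regular point of `V(closure Y)` over `x` (pv-003's bridge)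
  have hci := @IsClosedImmersion.comp _ _ _ ι _ hι hgci
  obtain ⟨w₀, hw₀, hw₀reg⟩ := @exists_vanishingIdeal_witness_of_not_isRegularLocalRing _ _ _ hci inferInstance _ hreg
  subst hY
  exact ⟨w₀, hw₀, hw₀reg, exists_first_progress_touch_of_horizChain (CategoryTheory.CategoryStruct.comp (AlgebraicGeometry.Proj.toSpecZero (MvPolynomial.homogeneousSubmodule (Fin (n + 1)) O)) (AlgebraicGeometry.Spec.map (CommRingCat.ofHom (algebraMap O (MvPolynomial.homogeneousSubmodule (Fin (n + 1)) O 0))))) _ hξ _ w₀ hw₀ hw₀reg hhr hregS⟩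

end Summit.ResolutionOfSingularities.ResolutionOfSingularities.Cruxes.EquisingularLiftNat.Sections
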